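import Literature.NumberTheory.EllipticCurves.PAdicLFunctionRiemannSumCertificateProofs
import Literature.NumberTheory.EllipticCurves.Rank1Residual.X1RankOneOddPrime
import HarnessLib

/-!
# Residual class X1 ∩ {r_an = 1}: the `[T¹]`-certificate in KERNEL form — one Riemann sum of the
# Mazur–Swinnerton-Dyer measure beating the truncation bound ⟹ `[T¹]L_p(E,T) ≠ 0` ⟹ Schneider's
# non-degeneracy for the canonical height (theorems only; no definition, no named fact)

Topic `Literature/NumberTheory/EllipticCurves/Rank1Residual`; a thin consumer joining two tree
files: `PAdicLFunctionRiemannSumCertificateProofs.lean` (crux stmt-0490 lead c4: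
`norm_padicLCoeff_sub_padicLRiemannSum_le` — the TRUNCATION BOUND
`‖c_k − RS(k, n)‖ ≤ (C/‖k!‖_p)·p⁻ⁿ` for the coefficients `c_k = padicLCoeff f α k` of
`L_p(f, α, T)` against the level-`n` Riemann sums `RS(k, n) = padicLRiemannSum f α k n` of the
measure `μ_{f,α}`, from the tree's Cauchy estimate `norm_padicLRiemannSum_succ_sub_le`; and the
CERTIFICATE CRITERION `norm_padicLCoeff_eq_of_lt`: `(C/‖k!‖_p)·p⁻ⁿ < ‖RS(k, n)‖ ⟹
‖c_k‖ = ‖RS(k, n)‖ ∧ c_k ≠ 0`) and `Rank1Residual/X1RankOneOddPrime.lean`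
(`X1.schneider_of_coeff_one_ne_zero_odd`: at an X1 pair of analytic rank one and odd `p`,
`[T¹]L_p(f, α, T) ≠ 0 ⟹` Schneider's conjecture for the canonical `p`-adic height, from
Perrin-Riou 1987 Cor. 1.8 (`hPR`) and GZK (`hGZK`); `X1.schneider_of_coeff_one_ne_zero` for
`p ≥ 5` with the every-`p` Perrin-Riou fact).

WHY (cell `b2b-bsdres`, lane CLASS-CLOSURE, class N1 / N1′ = X1 ∩ {r = 1}; register
`HOME/class-closure/N1/PREDICTIONS-N1COEFF1.md` §5, gap (g1)): the lane's N1-COEFF1 instrument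
certifies, per (class, `p`), `v_p(c₁(P_n)) < n − 1 − c_den` for the level-`pⁿ` Riemann sum
`c₁(P_n)` of the `ω₁`-normalised measure on two method-disjoint symbol engines and two folds — the
"precision rule" of Stein–Wuthrich 2013 §3 (Prop. 3.1 / 3.5), hitherto CITED. With this file the
rule is a tree theorem END TO END: an explicit measure bound `C` and ONE Riemann-sum inequality
give the binder `hcoeff : PowerSeries.coeff 1 (padicLFunction f (unitRoot W p : ℚ_[p])) ≠ 0`
(`coeff_one_padicLFunction_ne_zero_of_riemannSum_certificate`) and hence Schneider
(`X1.schneider_of_riemannSum_certificate_odd`). What remains OUTSIDE the kernel for an instrument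
row is exactly: (g2) the engines' `x⁺_E = u_E·[·]⁺_f` with `u_E ∈ ℚ^×` (msfromell / `ω₁`
normalisation vs `ratPlusSymbol`'s `Ω⁺_f`; the inequality is scale-covariant: `C` and `RS` both
scale by `|u_E|_p`), and the uniform bound `C` over ALL levels (the instrument reads `c_den` off
the delivered levels; a bound for every level is Manin–Drinfeld's common denominator,
`exists_norm_msdMeasure_le_of_isNewformOf`, explicit as `C = 1` when `E[p]` is irreducible and
`p` odd — `norm_msdMeasure_le_one` — which is NOT the X1 case; on X1 the bound is the member-1
lattice's symbol denominator, supplied per row). INDEXING: the tree's `padicLRiemannSum f α k n`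
sums over `s mod pⁿ` against `μ` at level `p^{n+e₀}` (`e₀ = 1` for odd `p`), i.e. it is the
instrument's `P_{n+1}`; the instrument's verdict `NON-ZERO(v)` at level `n* = n + 1` with
`K = n* − 1 − c_den = n − c_den > v` is the hypothesis `hlt` with `C = p^{c_den}` (same
normalisation). HONEST FRAMING: nothing about any curve is asserted; instrument rows are
EVIDENCE for the hypotheses `hC` / `hlt`, never kernel facts; nothing is booked; no label of
`RESIDUAL-MAP.md` moves. Cell seat cc-typer-6 GEN 7 (pen of the N1-COEFF1 register).

References: [SteinWuthrich2013] §3, Prop. 3.1 and 3.5; [MazurTateTeitelbaum1986Invent]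
§I.11–I.13; [PerrinRiou1987] §1.4 Cor. 1.8.
-/

noncomputable section

open scoped Classical MatrixGroups ModularForm
open CongruenceSubgroup WeierstrassCurve Literature.NumberTheory.EllipticCurves
  Literature.NumberTheory.EllipticCurves.ModularForms

namespace Literature.NumberTheory.EllipticCurves

/-! ### `coeff k ≠ 0` from one certified Riemann sum (elliptic curve, good ordinary `p`) -/

section Elliptic

variable {N : ℕ} [NeZero N] {f : CuspForm (Gamma0 N) 2} {p : ℕ} [Fact p.Prime]
  {W : WeierstrassCurve ℚ} [W.IsGloballyMinimal] [W.IsElliptic]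

/-- **Riemann-sum certificate for a coefficient of `L_p(E, T)`.** Let `E = W/ℚ` be globally
minimal and good ordinary at `p`, `f` its newform, `α = unitRoot W p`, and let `C` bound the
Mazur–Swinnerton-Dyer measure at every level, `‖μ_{f,α}(a + pᵐℤ_p)‖ ≤ C`. If ONE Riemann sum
beats the truncation bound, `(C/‖k!‖_p)·p⁻ⁿ < ‖RS(k, n)‖`, then the `k`-th coefficient of
`L_p(f, α, T)` is non-zero (and has the norm of `RS(k, n)`): `norm_padicLCoeff_eq_of_lt` with the
distribution relation supplied by the tree's `msdMeasure_distribution_of_isNewformOf`. (The same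
three lines as the rank-2 observatory's Summits-side `coeff_ne_zero_of_riemannSum_certificate` in
`Summits/…/Theorems/Rank2ObservatoryPadicRow.lean`, which a Literature file cannot import;
re-homed here for the Rank1Residual consumers below.)
[cite: SteinWuthrich2013, §3 Prop. 3.1 and 3.5] [cite: MazurTateTeitelbaum1986Invent, §I.11–I.13] -/
theorem coeff_padicLFunction_ne_zero_of_riemannSum_certificate (hord : IsOrdinaryAt W p)
    (hf : IsNewformOf W f) {C : ℝ}
    (hC : ∀ (n : ℕ) (a : ZMod (p ^ n)), ‖msdMeasure f (unitRoot W p : ℚ_[p]) n a‖ ≤ C) {k n : ℕ}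
    (hlt : C / ‖((k.factorial : ℕ) : ℚ_[p])‖ * (p : ℝ) ^ (-n : ℤ) <
      ‖padicLRiemannSum f (unitRoot W p : ℚ_[p]) k n‖) :
    PowerSeries.coeff k (padicLFunction f (unitRoot W p : ℚ_[p])) ≠ 0 := by
  rw [coeff_padicLFunction]
  exact (norm_padicLCoeff_eq_of_lt (msdMeasure_distribution_of_isNewformOf hord hf)
    ((norm_nonneg _).trans (hC 0 0)) hC hlt).2

/-- **… with the certified valuation:** under the same hypotheses
`‖coeff k (L_p(f, α, T))‖ = ‖RS(k, n)‖` — the instrument's informative column `v` IS `v_p(c_k)`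
in the same normalisation. [cite: SteinWuthrich2013, §3 Prop. 3.5] -/
theorem norm_coeff_padicLFunction_eq_of_riemannSum_certificate (hord : IsOrdinaryAt W p)
    (hf : IsNewformOf W f) {C : ℝ}
    (hC : ∀ (n : ℕ) (a : ZMod (p ^ n)), ‖msdMeasure f (unitRoot W p : ℚ_[p]) n a‖ ≤ C) {k n : ℕ}
    (hlt : C / ‖((k.factorial : ℕ) : ℚ_[p])‖ * (p : ℝ) ^ (-n : ℤ) <
      ‖padicLRiemannSum f (unitRoot W p : ℚ_[p]) k n‖) :
    ‖PowerSeries.coeff k (padicLFunction f (unitRoot W p : ℚ_[p]))‖ =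
      ‖padicLRiemannSum f (unitRoot W p : ℚ_[p]) k n‖ := by
  rw [coeff_padicLFunction]
  exact (norm_padicLCoeff_eq_of_lt (msdMeasure_distribution_of_isNewformOf hord hf)
    ((norm_nonneg _).trans (hC 0 0)) hC hlt).1

/-- **The `[T¹]`-certificate** — the shape the N1-COEFF1 / iw instruments compute: a measure
bound `C` and ONE level `n` with `C·p⁻ⁿ < ‖RS(1, n)‖` (i.e. `v_p(RS₁(n)) < n − c` for `C = pᶜ`)
give `[T¹]L_p(f, α, T) ≠ 0` — literally the binder `hcoeff` of
`Rank1Residual.X1.schneider_of_coeff_one_ne_zero_odd`. [cite: SteinWuthrich2013, §3 Prop. 3.5] -/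
theorem coeff_one_padicLFunction_ne_zero_of_riemannSum_certificate (hord : IsOrdinaryAt W p)
    (hf : IsNewformOf W f) {C : ℝ}
    (hC : ∀ (n : ℕ) (a : ZMod (p ^ n)), ‖msdMeasure f (unitRoot W p : ℚ_[p]) n a‖ ≤ C) {n : ℕ}
    (hlt : C * (p : ℝ) ^ (-n : ℤ) < ‖padicLRiemannSum f (unitRoot W p : ℚ_[p]) 1 n‖) :
    PowerSeries.coeff 1 (padicLFunction f (unitRoot W p : ℚ_[p])) ≠ 0 := by
  refine coeff_padicLFunction_ne_zero_of_riemannSum_certificate hord hf hC (k := 1) (n := n) ?_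
  rwa [Nat.factorial_one, Nat.cast_one, norm_one, div_one]

end Elliptic

/-! ### X1 ∩ {r_an = 1}: Riemann-sum certificate ⟹ Schneider -/

namespace Rank1Residual

variable {N : ℕ} [NeZero N]

/-- **X1, odd `p`: one certified Riemann sum ⟹ Schneider's conjecture for the canonical height.**
At a pair `(W, p)` in class X1 (`ClassX1 W p`: `p` good ordinary, `E[p]` reducible, …) with
`ord_{s=1} L(E, s) = 1`, `f` the newform of `W`: a measure bound `C` at every level and ONE level
`n` with `C·p⁻ⁿ < ‖RS(1, n)‖` give `[T¹]L_p(f, α, T) ≠ 0`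
(`coeff_one_padicLFunction_ne_zero_of_riemannSum_certificate`), hence — Perrin-Riou 1987 Cor. 1.8
(`hPR`, odd `p`) and GZK (`hGZK`), via `X1.schneider_of_coeff_one_ne_zero_odd` — Schneider's
non-degeneracy for every canonical `p`-adic height datum. The per-pair input of the X1 rank-one
routes (`hSch`) thus reduces to the two numerical hypotheses `hC`, `hlt` about the tree's own
measure. [cite: PerrinRiou1987, §1.4 Cor. 1.8] [cite: SteinWuthrich2013, §3 Prop. 3.5] -/
theorem X1.schneider_of_riemannSum_certificate_odd (hPR : perrinRiou_rankOne_leadingTerms_odd)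
    (hGZK : rank_eq_analyticRank_of_analyticRank_le_one)
    (W : WeierstrassCurve ℚ) [W.IsElliptic] [W.IsGloballyMinimal] (p : ℕ) [Fact p.Prime]
    (hX1 : ClassX1 W p) (han : W.analyticRank = 1)
    (f : CuspForm (Gamma0 N) 2) (hf : IsNewformOf W f) {C : ℝ}
    (hC : ∀ (n : ℕ) (a : ZMod (p ^ n)), ‖msdMeasure f (unitRoot W p : ℚ_[p]) n a‖ ≤ C) {n : ℕ}
    (hlt : C * (p : ℝ) ^ (-n : ℤ) < ‖padicLRiemannSum f (unitRoot W p : ℚ_[p]) 1 n‖) :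
    ∀ Dh : PAdicHeightData W p, Dh.IsCanonical → SchneiderConjecture Dh := by
  have hX := isClassX1_of_classX1 hX1
  exact X1.schneider_of_coeff_one_ne_zero_odd hPR hGZK W p hX1 han f hf
    (coeff_one_padicLFunction_ne_zero_of_riemannSum_certificate
      ⟨hX.hasGoodReductionAtPrime, hX.not_dvd_frobeniusTrace⟩ hf hC hlt)

/-- **X1, `p ≥ 5` (every-`p` Perrin-Riou fact): one certified Riemann sum ⟹ Schneider.** The same
through `X1.schneider_of_coeff_one_ne_zero` (`hPR : perrinRiou_rankOne_leadingTerms`).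
[cite: PerrinRiou1987, §1.4 Cor. 1.8] [cite: SteinWuthrich2013, §3 Prop. 3.5] -/
theorem X1.schneider_of_riemannSum_certificate (hPR : perrinRiou_rankOne_leadingTerms)
    (hGZK : rank_eq_analyticRank_of_analyticRank_le_one)
    (W : WeierstrassCurve ℚ) [W.IsElliptic] [W.IsGloballyMinimal] (p : ℕ) [Fact p.Prime]
    (hX1 : ClassX1 W p) (hp : 5 ≤ p) (han : W.analyticRank = 1)
    (f : CuspForm (Gamma0 N) 2) (hf : IsNewformOf W f) {C : ℝ}
    (hC : ∀ (n : ℕ) (a : ZMod (p ^ n)), ‖msdMeasure f (unitRoot W p : ℚ_[p]) n a‖ ≤ C) {n : ℕ}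
    (hlt : C * (p : ℝ) ^ (-n : ℤ) < ‖padicLRiemannSum f (unitRoot W p : ℚ_[p]) 1 n‖) :
    ∀ Dh : PAdicHeightData W p, Dh.IsCanonical → SchneiderConjecture Dh := by
  have hX := isClassX1_of_classX1 hX1
  exact X1.schneider_of_coeff_one_ne_zero hPR hGZK W p hX1 hp han f hf
    (coeff_one_padicLFunction_ne_zero_of_riemannSum_certificate
      ⟨hX.hasGoodReductionAtPrime, hX.not_dvd_frobeniusTrace⟩ hf hC hlt)

end Rank1Residual

end Literature.NumberTheory.EllipticCurves

end
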